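import Summits.HubbardSuperconductivity.HubbardSuperconductivity.Theorems.AnisotropyChordTransferFibre3L2CellClosure

/-!
# Route `AnisotropyChord` / H0 rotor rung, LEVEL 2 (`∀ L ≥ 128`): glueing CLOSED cells of the GM₃ window, and GM₃ from a closed box

Companion of `…L2CellClosure`.  A box `B = [ν₁, ν₂] × [a₁, a₂]` of the `(ν, a)` plane is CLOSED when every ground two-magnon profile
(`L ≥ 128`, `0 ≤ Δ < 1`) located in it admits constants `c, a, b` with the windowed regime clause and the three β-free rows (the
per-cell theorems `L2.closed_cellN…`).  This file: ★ `closed_glue_a` / ★ `closed_glue_nu` (two closed boxes sharing an `a`- resp.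
`ν`-edge give a closed union — the statement is an `∃`, so glueing is a case split on the profile's coordinate), ★ `closed_mono`
(a closed box stays closed on a sub-box), and ★★ `gm3_of_closed_box`: if the ground profiles of `(L, Δ)` (`L ≥ 128`, `0 < Δ < 1`) are
located in a closed box then `GM3Fibre L Δ` (`gm3_cellwise` + the box's closure).  With p2's location lemmas (`region_sides`,
`a_le_AbarQ`, `nu_eq_etaEff_div`) the closed columns become `∀ L ≥ 128` GM₃ theorems on `Δ`-ranges.
Prover seat `hubbard-h0-rotor-p1` g31 (route lead); helper for piece A = stmt-HubbardSuperconductivity-23918 of rung 19089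
(`--supports`, helper class).  Nothing here proves superconductivity in the Hubbard model; glue lemmas for ONE conditional
reduction (the GM₃ ∀L certificate).  Tree imports only; no sorry.
-/

set_option linter.dupNamespace false
set_option autoImplicit false

namespace Summit.HubbardSuperconductivity.HubbardSuperconductivity.Theorems.AnisotropyChord.Transfer.Fibre3

namespace L2

variable (L : ℕ) [NeZero L]

omit [NeZero L] in
/-- ★ glueing two closed `a`-ranges `[a₁, m]`, `[m, a₂]` of the same `ν`-column at `m` (any conclusion `P`, in particular the
`∃ c a b` closure statement). [folklore] -/
theorem closed_glue_a {Δ : ℝ} {f : Tor L → ℝ} {a1 m a2 : ℝ} {P : Prop}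
    (h1 : a1 ≤ Δ * f (K1 L) → Δ * f (K1 L) ≤ m → P) (h2 : m ≤ Δ * f (K1 L) → Δ * f (K1 L) ≤ a2 → P)
    (ha1 : a1 ≤ Δ * f (K1 L)) (ha2 : Δ * f (K1 L) ≤ a2) : P := by
  rcases le_total (Δ * f (K1 L)) m with h | h
  · exact h1 ha1 h
  · exact h2 h ha2

omit [NeZero L] in
/-- ★ glueing two closed `ν`-ranges `[ν₁, m]`, `[m, ν₂]` at `m`. [folklore] -/
theorem closed_glue_nu {lam2 : ℝ} {n1 m n2 : ℝ} {P : Prop}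
    (h1 : n1 ≤ lam2 / (2 * Real.pi / L) ^ 2 → lam2 / (2 * Real.pi / L) ^ 2 ≤ m → P)
    (h2 : m ≤ lam2 / (2 * Real.pi / L) ^ 2 → lam2 / (2 * Real.pi / L) ^ 2 ≤ n2 → P)
    (hν1 : n1 ≤ lam2 / (2 * Real.pi / L) ^ 2) (hν2 : lam2 / (2 * Real.pi / L) ^ 2 ≤ n2) : P := by
  rcases le_total (lam2 / (2 * Real.pi / L) ^ 2) m with h | h
  · exact h1 hν1 h
  · exact h2 h hν2

omit [NeZero L] in
/-- ★ a statement proved on a box holds on any sub-box (four `le_trans`). [folklore] -/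
theorem closed_mono {lam2 Δ : ℝ} {f : Tor L → ℝ} {n1 n2 a1 a2 n1' n2' a1' a2' : ℝ} {P : Prop}
    (h : n1 ≤ lam2 / (2 * Real.pi / L) ^ 2 → lam2 / (2 * Real.pi / L) ^ 2 ≤ n2 → a1 ≤ Δ * f (K1 L) → Δ * f (K1 L) ≤ a2 → P)
    (hn1 : n1 ≤ n1') (hn2 : n2' ≤ n2) (hb1 : a1 ≤ a1') (hb2 : a2' ≤ a2)
    (hν1 : n1' ≤ lam2 / (2 * Real.pi / L) ^ 2) (hν2 : lam2 / (2 * Real.pi / L) ^ 2 ≤ n2')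
    (ha1 : a1' ≤ Δ * f (K1 L)) (ha2 : Δ * f (K1 L) ≤ a2') : P :=
  h (hn1.trans hν1) (hν2.trans hn2) (hb1.trans ha1) (ha2.trans hb2)

/-- ★★ **GM₃ FROM A CLOSED BOX**: if every ground profile of `(L, Δ)` (`L ≥ 128`, `0 < Δ < 1`) lies in a box on which the closure
statement holds, then `GM3Fibre L Δ`. [folklore] -/
theorem gm3_of_closed_box (hL : 128 ≤ L) {Δ : ℝ} (hΔ0 : 0 < Δ) (hΔ1 : Δ < 1) (n1 n2 a1 a2 : ℝ)
    (hclosed : ∀ lam2 : ℝ, ∀ f : Tor L → ℝ, IsGroundTwoMagnon L Δ lam2 f →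
      n1 ≤ lam2 / (2 * Real.pi / L) ^ 2 → lam2 / (2 * Real.pi / L) ^ 2 ≤ n2 → a1 ≤ Δ * f (K1 L) → Δ * f (K1 L) ≤ a2 →
        ∃ c a b : ℝ,
          (0 ≤ mHole L Δ f ∧ facMI L Δ f * etaEff L lam2 * (a + b / (2 + Real.cos (2 * Real.pi / L))) < c) ∧
          c * Uunit L Δ f ≤ trialGapN1 L Δ f ∧
          lowGForm L Δ f ≤ a * etaEff L lam2 * Uunit L Δ f ∧
          (ip L (resid L Δ f) (resid L Δ f)).re - polePart L Δ f - lowNormPart L Δ f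
            ≤ b * etaEff L lam2 * (2 * eps1 L - Tplus L Δ f) * Uunit L Δ f)
    (hloc : ∀ lam2 : ℝ, ∀ f : Tor L → ℝ, IsGroundTwoMagnon L Δ lam2 f →
      n1 ≤ lam2 / (2 * Real.pi / L) ^ 2 ∧ lam2 / (2 * Real.pi / L) ^ 2 ≤ n2 ∧ a1 ≤ Δ * f (K1 L) ∧ Δ * f (K1 L) ≤ a2) :
    GM3Fibre L Δ := by
  refine gm3_cellwise L (by omega) hΔ0 hΔ1 fun lam2 f hf _ _ => ?_
  obtain ⟨h1, h2, h3, h4⟩ := hloc lam2 f hf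
  exact hclosed lam2 f hf h1 h2 h3 h4

end L2

end Summit.HubbardSuperconductivity.HubbardSuperconductivity.Theorems.AnisotropyChord.Transfer.Fibre3
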